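import Literature.NumberTheory.EllipticCurves.HasseWeilGoodReductionProofs
import Literature.NumberTheory.EllipticCurves.HasseManin
import Literature.NumberTheory.EllipticCurves.TateModuleContinuityProofs
import Literature.NumberTheory.Automorphic.AdicCompletionResidueCard
import Mathlib.LinearAlgebra.Matrix.ToLinearEquiv
import HarnessLib

/-!
# Frobenius powers on the Tate module: `ρ(Fr)^m − q_v^m` is injective on `T_p E` at a good place
# `v ∤ p`, and `T_p E` is `v`-adically separated — the two E-side inputs of THEOREM B of row T-DER
# (cell `b2b-bsdres`, team n1011, seat p11 GEN 8, OWNERS row T-DER = skel/T-DER.md STATUS v5; file F8a)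

HONEST FRAMING (cell `b2b-bsdres`, run/shared/lean/b2b/bsd-rank1-residual/, verbatim in every
file): the goal of the cell is to DELETE the COMBINATION-SHAPED residual classes of the
Birch–Swinnerton-Dyer formula for ALL analytic-rank `≤ 1` elliptic curves over `ℚ` — "full BSD
formula for every rank `≤ 1` curve in class `C`" assembled STRICTLY from published theorems — so
that the rank-`≤ 1` remainder becomes exactly the CONSTRUCTION-SHAPED classes, which are TYPED
(missing-input `Prop`s), NOT attempted. This is not "finishing BSD". Team n1011 (N10 / N11, the
additive block X4 ∧ `p = 3`): research route on the CONSTRUCTION-SHAPED class X4; no claim beyond the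
stated classes; nothing is booked. TOOL theorems (no definition, no named fact, no `sorry`): the
two displayed hypotheses `hV` (separation) and `hFrob` (Frobenius-power injectivity) of F6
`Inertia.apply_eq_zero_of_mem_inertia` DISCHARGED for the Tate module of an elliptic curve over a
number field at a good place `v ∤ p`.  No Euler system and no Selmer structure occurs.

## What

§1 Linear algebra (any commutative ring `R`; for the last two lemmas a domain of characteristic
zero and a free module of rank `2`): if `f² = a f − q` (`a, q ∈ ℤ`), the traces `t_m = tr(f^m)` are
the integers `2u_{m+1} − a u_m` of the Lucas pair (`u_{m+1}² − a u_{m+1} u_m + q u_m² = q^m`,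
`exists_trace_pow_eq`), whence `t_m² − 4q^m = (a² − 4q) u_m² ≤ 0` under Hasse's `a² ≤ 4q`
(`exists_trace_pow_eq_sq_le`); `det(q^m − f^m) = q^m (q^m + 1 − t_m)` is then a NONZERO integer for
`q ≥ 2`, `m ≥ 1` (`(q^m + 1)² > 4q^m`), so `f^m − q^m` is injective
(`injective_pow_sub_smul_of_charpoly`, via `injective_of_det_ne_zero` = Mathlib's
`Matrix.exists_mulVec_eq_zero_iff` in a basis).
§2 `T_p E` over a number field `K`, `v ∤ p`: `exists_addSubgroup_tateModule` — `T_p E` is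
`v`-adically separated (`V_n = ker(T_p E → E[p^n])` is open for the profinite topology, contains
`p^n · T_p E`, and some `V_n` misses any `x ≠ 0`) = F6's `hV`; `frobeniusTraceAt_sq_le_four_mul` —
Hasse `a_v² ≤ 4 q_v` over a number field (the tree's `HasseManin.abs_card_sub_le` on `Ẽ_v/k_v`; the
strict `ℚ`-form is the tree's `frobeniusTraceAt_sq_lt_four_mul`); `injective_galoisRepTate_pow_sub`
— **`ρ(Fr)^m − q_v^m` is injective on `T_p E`** for every arithmetic Frobenius `Fr` at every `𝔓 ∣ v`
of good reduction and `m ≥ 1` = F6's `hFrob` (the tree's `charpoly_galoisRepTate_of_hasGoodReductionAt`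
with the discharged `trace/det_galoisRepTate_frobenius_of_hasGoodReductionAt_holds`, and §1): the
Frobenius of `T_p E` has no eigenvalue `q_v^m`, its eigenvalues being Weil numbers of absolute value
`q_v^{1/2}` (here in the elementary integer form `|tr Fr^m| ≤ 2 q_v^{m/2} < q_v^m + 1`).

References: J. H. Silverman, *AEC*, Thm. V.1.1 (Hasse), Thm. V.2.3.1, Prop. VII.4.1, C.21 Remark
21.3; K. Rubin, *Euler Systems* (2000), Lemma 1.3.5; K. Rubin, PCMS 18 (2011), §3.1 (p. 30).
-/

noncomputable section

open CategoryTheory Function Finset Polynomial Field IsDedekindDomain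
open scoped NumberField
open Literature.NumberTheory.GaloisRepresentations Literature.NumberTheory.EllipticCurves

universe u

namespace Summit.BirchSwinnertonDyer.Rank1Residual.GaloisImage

namespace Derivative

/-! ### §1 Linear algebra in rank two: traces of powers and injectivity of `f^m − q^m` -/

section Algebra

variable {R : Type*} [CommRing R] {M : Type*} [AddCommGroup M] [Module R M]

/-- **Traces of powers from Cayley–Hamilton in rank two.**  If `f² = a f − q` in `End_R(M)`,
`tr(1) = 2` and `tr(f) = a` (`a, q ∈ ℤ`), then for every `m` there are integers `u = u_m`,
`u′ = u_{m+1}` (the Lucas sequence `u_0 = 0`, `u_1 = 1`, `u_{m+2} = a u_{m+1} − q u_m`) with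
`tr(f^m) = 2u′ − a u`, `tr(f^{m+1}) = a u′ − 2q u` and `u′² − a u′ u + q u² = q^m`.  [folklore] -/
theorem exists_trace_pow_eq (f : Module.End R M) (a q : ℤ)
    (hf : f * f = (a : R) • f - (q : R) • 1) (htr0 : LinearMap.trace R M 1 = 2)
    (htr1 : LinearMap.trace R M f = a) (m : ℕ) :
    ∃ u u' : ℤ, LinearMap.trace R M (f ^ m) = ((2 * u' - a * u : ℤ) : R) ∧
      LinearMap.trace R M (f ^ (m + 1)) = ((a * u' - 2 * q * u : ℤ) : R) ∧
      u' ^ 2 - a * u' * u + q * u ^ 2 = q ^ m := by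
  -- the two-term recursion for the powers and their traces
  have hrec : ∀ n : ℕ, f ^ (n + 2) = (a : R) • f ^ (n + 1) - (q : R) • f ^ n := fun n => by
    rw [pow_succ, pow_succ, mul_assoc, hf, mul_sub, mul_smul_comm, mul_smul_comm, mul_one, ← pow_succ]
  have htrec : ∀ n : ℕ, LinearMap.trace R M (f ^ (n + 2)) =
      (a : R) * LinearMap.trace R M (f ^ (n + 1)) - (q : R) * LinearMap.trace R M (f ^ n) := fun n => by
    rw [hrec, map_sub, map_smul, map_smul, smul_eq_mul, smul_eq_mul]
  induction m with
  | zero =>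
    refine ⟨0, 1, ?_, ?_, by ring⟩
    · rw [pow_zero, htr0]; push_cast; ring
    · rw [zero_add, pow_one, htr1]; push_cast; ring
  | succ m ih =>
    obtain ⟨u, u', h1, h2, h3⟩ := ih
    refine ⟨u', a * u' - q * u, ?_, ?_, ?_⟩
    · rw [h2]; push_cast; ring
    · rw [show m + 1 + 1 = m + 2 from rfl, htrec, h2, h1]; push_cast; ring
    · linear_combination (q : ℤ) * h3

/-- **Hasse ⇒ `tr(f^m)² ≤ 4 q^m`**: with the data of `exists_trace_pow_eq` and `a² ≤ 4q`, the
integer `t_m` with `tr(f^m) = t_m` satisfies `t_m² ≤ 4 q^m` (`t_m² − 4q^m = (a² − 4q) u_m²`).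
[folklore] -/
theorem exists_trace_pow_eq_sq_le (f : Module.End R M) (a q : ℤ)
    (hf : f * f = (a : R) • f - (q : R) • 1) (htr0 : LinearMap.trace R M 1 = 2)
    (htr1 : LinearMap.trace R M f = a) (hasse : a ^ 2 ≤ 4 * q) (m : ℕ) :
    ∃ t : ℤ, LinearMap.trace R M (f ^ m) = (t : R) ∧ t ^ 2 ≤ 4 * q ^ m := by
  obtain ⟨u, u', h1, -, h3⟩ := exists_trace_pow_eq f a q hf htr0 htr1 m
  refine ⟨2 * u' - a * u, h1, ?_⟩
  have key : (2 * u' - a * u) ^ 2 - 4 * q ^ m = (a ^ 2 - 4 * q) * u ^ 2 := by rw [← h3]; ring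
  nlinarith [sq_nonneg u]

/-- Over an integral domain, an endomorphism of a finite free module with non-zero determinant is
injective (via a basis and Mathlib's `Matrix.exists_mulVec_eq_zero_iff`). [folklore] -/
theorem injective_of_det_ne_zero [IsDomain R] [Module.Free R M] [Module.Finite R M]
    (g : Module.End R M) (hg : LinearMap.det g ≠ 0) : Function.Injective g := by
  classical
  let b := Module.Free.chooseBasis R M
  rw [← LinearMap.ker_eq_bot, LinearMap.ker_eq_bot']
  intro x hx
  by_contra hx0
  have hv : (b.repr x : Module.Free.ChooseBasisIndex R M → R) ≠ 0 := by
    intro h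
    apply hx0
    have : b.repr x = 0 := Finsupp.coe_eq_zero.mp h
    simpa using this
  have hmul : (LinearMap.toMatrix b b g).mulVec (b.repr x : _ → R) = 0 := by
    rw [LinearMap.toMatrix_mulVec_repr, hx, map_zero]
    rfl
  have hdet : (LinearMap.toMatrix b b g).det = 0 :=
    Matrix.exists_mulVec_eq_zero_iff.mp ⟨_, hv, hmul⟩
  rw [LinearMap.det_toMatrix] at hdet
  exact hg hdet

/-- **`f^m − q^m` is injective** on a free rank-`2` module over a domain of characteristic zero when
`χ_f = X² − aX + q` with integers `a, q`, `a² ≤ 4q` (Hasse), `q ≥ 2` and `m ≥ 1`: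
`det(q^m − f^m) = χ_{f^m}(q^m) = q^{2m} − tr(f^m) q^m + q^m = q^m (q^m + 1 − t_m) ≠ 0` since
`t_m² ≤ 4q^m < (q^m + 1)²`.  (Frobenius of `T_p E` at a good prime has no eigenvalue `q^m`: its
eigenvalues are Weil numbers of absolute value `q^{1/2}`.) [folklore] -/
theorem injective_pow_sub_smul_of_charpoly [IsDomain R] [CharZero R] [Module.Free R M]
    [Module.Finite R M] (h2 : Module.finrank R M = 2) (f : Module.End R M) (a : ℤ) (q : ℕ)
    (hchar : f.charpoly = X ^ 2 - C (a : R) * X + C (q : R)) (hasse : a ^ 2 ≤ 4 * (q : ℤ))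
    (hq : 2 ≤ q) {m : ℕ} (hm : 0 < m) :
    Function.Injective fun x : M => (f ^ m) x - ((q : R) ^ m) • x := by
  classical
  haveI : Nontrivial R := inferInstance
  -- charpoly of any endomorphism in rank 2, trace and det of `f`
  let b := Module.finBasisOfFinrankEq R M h2
  have hcp : ∀ g : Module.End R M,
      g.charpoly = X ^ 2 - C (LinearMap.trace R M g) * X + C (LinearMap.det g) := fun g => by
    rw [← LinearMap.charpoly_toMatrix g b, Matrix.charpoly_fin_two,
      ← LinearMap.trace_eq_matrix_trace R b g, LinearMap.det_toMatrix b g]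
  have hcoef := hcp f
  rw [hchar] at hcoef
  have htr1 : LinearMap.trace R M f = a := by
    have h := congrArg (fun P : R[X] => P.coeff 1) hcoef
    simp only [coeff_add, coeff_sub, coeff_C_mul, coeff_X_pow, coeff_X_one, coeff_C,
      if_neg (one_ne_zero), mul_one] at h
    simpa using h.symm
  have hdet : LinearMap.det f = (q : R) := by
    have h := congrArg (fun P : R[X] => P.coeff 0) hcoef
    simpa using h.symm
  have htr0 : LinearMap.trace R M (1 : Module.End R M) = 2 := by
    rw [LinearMap.trace_one, h2]; norm_num
  -- Cayley–Hamilton: `f² = a f − q`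
  have hf : f * f = (a : R) • f - ((q : ℤ) : R) • 1 := by
    have h := LinearMap.aeval_self_charpoly f
    rw [hchar] at h
    simp only [map_add, map_sub, map_mul, aeval_X_pow, aeval_C, aeval_X,
      Algebra.algebraMap_eq_smul_one] at h
    rw [Int.cast_natCast]
    have h' : f ^ 2 = (a : R) • (1 : Module.End R M) * f - (q : R) • 1 := by
      rw [← sub_eq_zero]; rw [← h]; abel
    rw [sq] at h'
    rw [h', smul_one_mul]
  -- the integer trace of `f^m` and its Hasse bound
  obtain ⟨t, ht, htle⟩ := exists_trace_pow_eq_sq_le f a q hf htr0 (by exact_mod_cast htr1)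
    (by exact_mod_cast hasse) m
  -- `det (q^m − f^m)` is the non-zero integer `q^m (q^m + 1 − t)`
  have hqm : (2 : ℤ) ≤ (q : ℤ) ^ m := by
    calc (2 : ℤ) ≤ q := by exact_mod_cast hq
      _ = (q : ℤ) ^ 1 := (pow_one _).symm
      _ ≤ (q : ℤ) ^ m := pow_le_pow_right₀ (by omega) hm
  have hne : (q : ℤ) ^ m * ((q : ℤ) ^ m + 1 - t) ≠ 0 := by
    refine mul_ne_zero (by positivity) fun h => ?_
    have ht' : t = (q : ℤ) ^ m + 1 := by linarith
    rw [ht'] at htle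
    nlinarith
  have hdetm : LinearMap.det (algebraMap R (Module.End R M) ((q : R) ^ m) - f ^ m) =
      (((q : ℤ) ^ m * ((q : ℤ) ^ m + 1 - t) : ℤ) : R) := by
    rw [← LinearMap.eval_charpoly, hcp (f ^ m), ht, map_pow, hdet]
    simp only [eval_add, eval_sub, eval_mul, eval_pow, eval_C, eval_X]
    push_cast
    ring
  have hdet0 : LinearMap.det (algebraMap R (Module.End R M) ((q : R) ^ m) - f ^ m) ≠ 0 := by
    rw [hdetm]
    exact_mod_cast hne
  have hinj := injective_of_det_ne_zero _ hdet0
  -- `x ↦ f^m x − q^m x` is the negative of that endomorphism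
  intro x y hxy
  apply hinj
  have h : (f ^ m) x - ((q : R) ^ m) • x = (f ^ m) y - ((q : R) ^ m) • y := hxy
  simp only [LinearMap.sub_apply, Module.algebraMap_end_apply]
  rw [← neg_sub, ← neg_sub (((f ^ m) y)), neg_inj]
  exact h

end Algebra

/-! ### §2 The Tate module of an elliptic curve at a good place `v ∤ p` -/

section Tate

variable {K : Type u} [Field K] [NumberField K] (W : WeierstrassCurve K) [W.IsElliptic]
  (p : ℕ) [Fact p.Prime]

omit [NumberField K] [W.IsElliptic] [Fact p.Prime] in
/-- **`hV` for `T_p E`: the Tate module is `v`-adically separated for every `v ∤ p`.**  For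
`x ≠ 0` some coordinate `x_n ∈ E[p^n]` is non-zero; `V_n = ker(T_p E → E[p^n])` is an open
subgroup (the topology of `T_p E` is the product topology, `E(K̄)` discrete) missing `x` and
containing `p^n · T_p E`, and `p^n` is prime to `v`. [folklore] -/
theorem exists_addSubgroup_tateModule {v : HeightOneSpectrum (𝓞 K)} (hpv : ((p : ℕ) : 𝓞 K) ∉ v.asIdeal)
    (x : W.tateModule p) (hx : x ≠ 0) :
    ∃ (V : AddSubgroup (W.tateModule p)) (N : ℕ), IsOpen (V : Set (W.tateModule p)) ∧ x ∉ V ∧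
      (N : 𝓞 K) ∉ v.asIdeal ∧ ∀ y : W.tateModule p, N • y ∈ V := by
  -- a non-zero coordinate
  have hex : ∃ n, TateModule.proj p n x ≠ 0 := by
    by_contra h
    push Not at h
    exact hx (TateModule.ext fun n => by rw [h n, map_zero])
  obtain ⟨n, hn⟩ := hex
  refine ⟨(TateModule.proj p n : W.tateModule p →+ WeierstrassCurve.geomPoints W).ker, p ^ n, ?_, ?_, ?_, fun y => ?_⟩
  · have h : ((TateModule.proj p n : W.tateModule p →+ WeierstrassCurve.geomPoints W).ker : Set (W.tateModule p)) =
        (TateModule.proj p n : W.tateModule p →+ WeierstrassCurve.geomPoints W) ⁻¹' {0} := by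
      ext y; simp [AddMonoidHom.mem_ker]
    rw [h]
    exact (isOpen_discrete _).preimage (TateModule.continuous_proj (A := WeierstrassCurve.geomPoints W) (p := p) n)
  · rwa [AddMonoidHom.mem_ker]
  · rw [Nat.cast_pow]
    exact fun h => hpv (v.isPrime.mem_of_pow_mem n h)
  · rw [AddMonoidHom.mem_ker, map_nsmul]
    exact TateModule.pow_smul_proj n y

omit [W.IsElliptic] in
/-- The residue field of `v` has at least two elements: `q_v = N v ≥ 2`. [folklore] -/
theorem two_le_residueCard (v : HeightOneSpectrum (𝓞 K)) : 2 ≤ v.residueCard := by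
  have h0 : v.residueCard ≠ 0 := by
    rw [HeightOneSpectrum.residueCard]
    exact Ideal.absNorm_ne_zero_of_nonZeroDivisors ⟨v.asIdeal, mem_nonZeroDivisors_of_ne_zero v.ne_bot⟩
      |> fun h => by simpa using h
  have h1 : v.residueCard ≠ 1 := by
    rw [HeightOneSpectrum.residueCard, Ne, Ideal.absNorm_eq_one_iff]
    exact v.isPrime.ne_top
  omega

omit [W.IsElliptic] in
/-- **Hasse's bound at a good place of a number field, `a_v² ≤ 4 q_v`** (Silverman, *AEC*,
Thm. V.1.1, for the reduction `Ẽ_v / k_v`; the tree's `HasseManin.abs_card_sub_le`). The strict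
form `a_v² < 4p` over `ℚ` is the tree's `frobeniusTraceAt_sq_lt_four_mul`.
[cite: SilvermanAEC2009, Thm. V.1.1] -/
theorem frobeniusTraceAt_sq_le_four_mul {v : HeightOneSpectrum (𝓞 K)} (hv : W.HasGoodReductionAt v) :
    W.frobeniusTraceAt v ^ 2 ≤
      4 * (Nat.card (IsLocalRing.ResidueField (v.adicCompletionIntegers K)) : ℤ) := by
  set k := IsLocalRing.ResidueField (v.adicCompletionIntegers K) with hkdef
  have hk : Nat.card k = v.residueCard := by
    rw [hkdef, HeightOneSpectrum.natCard_residueField_adicCompletionIntegers,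
      HeightOneSpectrum.residueCard_eq_card_quotient]
  haveI : Finite k := Nat.finite_of_card_ne_zero (by rw [hk]; have := two_le_residueCard v; omega)
  letI : Fintype k := Fintype.ofFinite k
  haveI : (W.reductionAt v).IsElliptic := WeierstrassCurve.isElliptic_reductionAt hv
  have hH := Literature.NumberTheory.EllipticCurves.HasseManin.abs_card_sub_le (W.reductionAt v)
  set a : ℤ := W.frobeniusTraceAt v with ha
  have hcard : (Nat.card k : ℝ) = (Fintype.card k : ℝ) := by rw [Nat.card_eq_fintype_card]
  have haR : (a : ℝ) = ((Fintype.card k : ℝ) + 1) -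
      (Nat.card (W.reductionAt v).toAffine.Point : ℝ) := by
    rw [ha, WeierstrassCurve.frobeniusTraceAt_def, ← Nat.card_eq_fintype_card (α := k)]
    push_cast
    ring
  have habs : |(a : ℝ)| ≤ 2 * Real.sqrt (Fintype.card k) := by
    rw [haR, abs_sub_comm]
    exact hH
  have h0 : (0 : ℝ) ≤ Fintype.card k := Nat.cast_nonneg _
  have hsqR : ((a ^ 2 : ℤ) : ℝ) ≤ ((4 * (Nat.card k : ℤ) : ℤ) : ℝ) := by
    push_cast
    rw [hcard]
    have h1 : (a : ℝ) ^ 2 ≤ (2 * Real.sqrt (Fintype.card k)) ^ 2 := by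
      rw [← sq_abs (a : ℝ)]
      exact pow_le_pow_left₀ (abs_nonneg _) habs 2
    calc (a : ℝ) ^ 2 ≤ (2 * Real.sqrt (Fintype.card k)) ^ 2 := h1
      _ = 4 * (Fintype.card k : ℝ) := by rw [mul_pow, Real.sq_sqrt h0]; norm_num
  exact_mod_cast hsqR

/-- **`hFrob` for `T_p E`: `ρ(Fr)^m − q_v^m` is injective on `T_p E`** for every arithmetic
Frobenius `Fr` at every `𝔓 ∣ v`, `v ∤ p` of good reduction, and every `m ≥ 1` — the Frobenius of
`T_p E` has no eigenvalue `q_v^m` (Hasse–Weil: its eigenvalues have absolute value `q_v^{1/2}`).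
Inputs: `charpoly_galoisRepTate_of_hasGoodReductionAt` with the tree's discharged
`trace/det_galoisRepTate_frobenius_of_hasGoodReductionAt_holds` (`χ = X² − a_v X + q_v`,
Silverman C.21), `frobeniusTraceAt_sq_le_four_mul`, and §1.
[cite: SilvermanAEC2009, Thm. V.1.1 and C.21 Remark 21.3] -/
theorem injective_galoisRepTate_pow_sub {v : HeightOneSpectrum (𝓞 K)}
    (hpv : ((p : ℕ) : 𝓞 K) ∉ v.asIdeal) (hv : W.HasGoodReductionAt v)
    {𝔓 : Ideal (absIntegers (𝓞 K) K)} (h𝔓 : 𝔓 ∈ v.primesAbove) {σ : absoluteGaloisGroup K}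
    (hσ : IsArithFrobAt (𝓞 K) σ 𝔓) {m : ℕ} (hm : 0 < m) :
    Function.Injective fun x : W.tateModule p =>
      W.galoisRepTate p (σ ^ m) x - ((v.residueCard : ℤ_[p]) ^ m) • x := by
  haveI := W.module_free_tateModule_holds p
  haveI := W.module_finite_tateModule_holds p
  have hpK : (p : K) ≠ 0 := by exact_mod_cast (Fact.out : p.Prime).ne_zero
  have hchar := WeierstrassCurve.charpoly_galoisRepTate_of_hasGoodReductionAt
    (W.trace_galoisRepTate_frobenius_of_hasGoodReductionAt_holds p)
    (W.det_galoisRepTate_frobenius_of_hasGoodReductionAt_holds p) hpv hv h𝔓 hσ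
  have hq : Nat.card (IsLocalRing.ResidueField (v.adicCompletionIntegers K)) = v.residueCard := by
    rw [HeightOneSpectrum.natCard_residueField_adicCompletionIntegers,
      HeightOneSpectrum.residueCard_eq_card_quotient]
  rw [hq] at hchar
  have hasse := frobeniusTraceAt_sq_le_four_mul W hv
  rw [hq] at hasse
  have h := injective_pow_sub_smul_of_charpoly (WeierstrassCurve.finrank_tateModule_eq_two_holds W p hpK)
    (W.galoisRepTate p σ) (W.frobeniusTraceAt v) v.residueCard hchar hasse (two_le_residueCard v) hm
  rw [map_pow]
  exact h

end Tate

end Derivative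

end Summit.BirchSwinnertonDyer.Rank1Residual.GaloisImage

end
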